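import Mathlib.Analysis.Complex.Schwarz
import Mathlib.Topology.MetricSpace.HausdorffDistance
import HarnessLib

/-!
# The conformal radius about `0` of the complement of a set in the unit disc; Koebe's `1/4` theorem

Trunk support (complex analysis) for `Literature/Probability/Percolation/` (the one-arm exponent
of critical percolation, Lawler–Schramm–Werner 2002, where the quantity studied is the conformal
radius `𝔯(θ)` of the component of `0` in `𝕌 ∖ Q(θ)`, eq. (2.1)–(2.2)).

For `K ⊆ ℂ` let `U` be the connected component of `0` in `𝔻 ∖ K` (`𝔻 = ball 0 1`). When `U` is
simply connected — the case in LSW, where `K ⊇ ∂𝔻` is connected — its **conformal radius about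
`0`** is `𝔯 = 1/ψ'(0)` for the Riemann map `ψ : U → 𝔻` with `ψ(0) = 0`, `ψ'(0) > 0`
(LSW p. 4; G. F. Lawler, *Conformally invariant processes in the plane*, AMS (2005), §3.2: the
correspondence `f ↔ f(𝔻)` between normalised univalent functions and simply connected domains).
By the Schwarz lemma, `𝔯` is also the largest value of `|φ'(0)|` over univalent (= holomorphic
and injective) `φ : 𝔻 → U` with `φ(0) = 0` (for such `φ`, `ψ ∘ φ : 𝔻 → 𝔻` fixes `0`, so
`|φ'(0)| ψ'(0) ≤ 1`, with equality for `φ = ψ⁻¹`). We take this extremal description as the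
DEFINITION (`conformalRadius K`), which needs neither the Riemann mapping theorem nor a
simple-connectivity hypothesis, is visibly antitone in `K`, and is `0` when `0 ∈ K`; a univalent
`φ : 𝔻 → 𝔻 ∖ K` with `φ(0) = 0` automatically lands in `U` (its image is connected and contains
`0`).

Main results:

* `conformalRadius_le_one` (Schwarz lemma, Mathlib's `Complex.norm_deriv_le_div_of_mapsTo_ball`);
* `min_infDist_one_le_conformalRadius : min (dist(0, K)) 1 ≤ 𝔯(K)` — the dilation
  `z ↦ d z`, `d = min (dist(0, K)) 1`, is admissible; this is the half `dist(0, Q) ≤ 𝔯` of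
  LSW (2.1) (there `K ⊇ ∂𝕌`, so `dist(0, K) ≤ 1`);
* `KoebeQuarter` — **Koebe's one-quarter theorem** as a named fact (Lawler 2005, Thm. 3.17:
  "If `f ∈ 𝒮`, then `𝓑(0, 1/4) ⊂ f(𝔻)`", stated for un-normalised univalent `f` on `𝔻` as in
  the proof of his Cor. 3.19): not in Mathlib (it rests on the area theorem, Prop. 3.13, and
  Bieberbach's `|a₂| ≤ 2`, Prop. 3.16); `KoebeCovering c` — the same with an unspecified
  constant `c` in place of `1/4` (Koebe 1907), which is all the one-arm exponent needs;
* `conformalRadius_le_inv_mul_infDist : 𝔯(K) ≤ c⁻¹ dist(0, K)` from `KoebeCovering c`, and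
  `conformalRadius_le_four_mul_infDist : 𝔯(K) ≤ 4 dist(0, K)` from `KoebeQuarter` — the half
  `𝔯/4 ≤ dist(0, Q)` of LSW (2.1) ("A well known consequence of the Koebe 1/4 Theorem and the
  Schwarz Lemma", LSW p. 4);
* `conformalRadius_eq_inv_norm_deriv` — agreement with LSW's definition: if `ψ` is a conformal
  map of the component `U` of `0` in `𝔻 ∖ K` onto `𝔻` with `ψ(0) = 0` (as provided by the
  Riemann mapping theorem, `Complex.exists_bijOn_ball_of_isSimplyConnected` in
  `Literature/Analysis/Complex/RiemannMapping.lean`, whenever `U` is simply connected), then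
  `𝔯(K) = 1/|ψ'(0)|` (Schwarz lemma both ways).

## References

* G. F. Lawler, O. Schramm, W. Werner, *One-arm exponent for critical 2D percolation*, Electron.
  J. Probab. 7 (2002), no. 2, §2, (2.1) (p. 4) [LawlerSchrammWernerEJP2002].
* G. F. Lawler, *Conformally invariant processes in the plane*, Math. Surveys Monogr. 114, AMS
  (2005; reprinted 2008), §3.2, Thm. 3.17 (Koebe 1/4), Cor. 3.19 [Lawler2008].
-/

noncomputable section

open Metric Set Filter Topology

namespace Literature.Analysis.Complex

/-- The admissible maps in the extremal description of the conformal radius of (the component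
of `0` in) `𝔻 ∖ K` about `0`: `φ` is holomorphic and injective on the unit disc `𝔻 = ball 0 1`
(univalent), fixes `0`, and maps `𝔻` into `𝔻 ∖ K`. (Lawler 2005, §3.2: "We say that a function
`f : D → ℂ` is univalent if it is analytic and one-to-one on `D`.")
[cite: Lawler2008, §3.2 (p. 61)] -/
structure IsUnivalentInto (K : Set ℂ) (φ : ℂ → ℂ) : Prop where
  differentiableOn : DifferentiableOn ℂ φ (ball 0 1)
  injOn : InjOn φ (ball 0 1)
  map_zero : φ 0 = 0
  mapsTo : MapsTo φ (ball 0 1) (ball 0 1 \ K)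

/-- The set of values `|φ'(0)|` over admissible univalent maps `φ : 𝔻 → 𝔻 ∖ K`, `φ(0) = 0`.
[cite: Lawler2008, §3.2 (p. 61)] -/
def conformalRadiusSet (K : Set ℂ) : Set ℝ :=
  {r | ∃ φ : ℂ → ℂ, IsUnivalentInto K φ ∧ r = ‖deriv φ 0‖}

/-- The **conformal radius about `0`** of (the connected component of `0` in) `𝔻 ∖ K`, in its
extremal form: the supremum of `|φ'(0)|` over univalent `φ : 𝔻 → 𝔻 ∖ K` with `φ(0) = 0`
(and `0` if there is none, i.e. if `0 ∈ K`). For the LSW sets `K = Q(θ) ⊇ ∂𝕌` this is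
`𝔯(θ) = 1/ψ'(0)`, `ψ` the normalised Riemann map of the component `U(θ)` of `0` in `𝕌 ∖ Q(θ)`
(LSW 2002, p. 4), by the Schwarz lemma and the Riemann mapping theorem (see the module
docstring). [cite: LawlerSchrammWernerEJP2002, §2 (p. 4)] [cite: Lawler2008, §3.2 (p. 61)] -/
def conformalRadius (K : Set ℂ) : ℝ :=
  sSup (insert 0 (conformalRadiusSet K))

variable {K K' : Set ℂ} {φ : ℂ → ℂ}

/-- An admissible map sends `𝔻` into `𝔻`. [folklore] -/
theorem IsUnivalentInto.mapsTo_ball (h : IsUnivalentInto K φ) : MapsTo φ (ball 0 1) (ball 0 1) :=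
  fun _ hz => (h.mapsTo hz).1

/-- **Schwarz lemma** for admissible maps: `|φ'(0)| ≤ 1` (Mathlib's
`Complex.norm_deriv_le_div_of_mapsTo_ball`). [folklore] -/
theorem IsUnivalentInto.norm_deriv_le_one (h : IsUnivalentInto K φ) : ‖deriv φ 0‖ ≤ 1 := by
  have hmaps : MapsTo φ (ball 0 1) (closedBall (φ 0) 1) := by
    intro z hz
    rw [h.map_zero]
    exact ball_subset_closedBall (h.mapsTo_ball hz)
  simpa using Complex.norm_deriv_le_div_of_mapsTo_ball h.differentiableOn hmaps one_pos

/-- Admissibility is antitone in `K`. [folklore] -/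
theorem IsUnivalentInto.mono (h : IsUnivalentInto K' φ) (hK : K ⊆ K') : IsUnivalentInto K φ :=
  ⟨h.differentiableOn, h.injOn, h.map_zero, fun _ hz => ⟨(h.mapsTo hz).1,
    fun hK' => (h.mapsTo hz).2 (hK hK')⟩⟩

/-- If `0 ∈ K` there is no admissible map. [folklore] -/
theorem IsUnivalentInto.zero_notMem (h : IsUnivalentInto K φ) : (0 : ℂ) ∉ K := by
  intro h0
  have := h.mapsTo (mem_ball_self one_pos)
  rw [h.map_zero] at this
  exact this.2 h0

/-- The set of admissible derivative sizes is bounded above by `1`. [folklore] -/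
theorem conformalRadiusSet_le_one {r : ℝ} (hr : r ∈ insert 0 (conformalRadiusSet K)) : r ≤ 1 := by
  rcases hr with rfl | ⟨φ, hφ, rfl⟩
  · exact zero_le_one
  · exact hφ.norm_deriv_le_one

/-- The set of admissible derivative sizes (with `0` adjoined) is bounded above. [folklore] -/
theorem bddAbove_conformalRadiusSet (K : Set ℂ) : BddAbove (insert 0 (conformalRadiusSet K)) :=
  ⟨1, fun _ hr => conformalRadiusSet_le_one hr⟩

/-- `0 ≤ 𝔯(K)`. [folklore] -/
theorem conformalRadius_nonneg (K : Set ℂ) : 0 ≤ conformalRadius K :=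
  le_csSup (bddAbove_conformalRadiusSet K) (mem_insert 0 _)

/-- `𝔯(K) ≤ 1` (Schwarz lemma). [folklore] -/
theorem conformalRadius_le_one (K : Set ℂ) : conformalRadius K ≤ 1 :=
  csSup_le (insert_nonempty 0 _) fun _ hr => conformalRadiusSet_le_one hr

/-- Every admissible map bounds the conformal radius from below: `|φ'(0)| ≤ 𝔯(K)`. [folklore] -/
theorem IsUnivalentInto.norm_deriv_le_conformalRadius (h : IsUnivalentInto K φ) :
    ‖deriv φ 0‖ ≤ conformalRadius K :=
  le_csSup (bddAbove_conformalRadiusSet K) (mem_insert_of_mem 0 ⟨φ, h, rfl⟩)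

/-- Upper bounds for the conformal radius: it suffices to bound every admissible `|φ'(0)|` by a
nonnegative number. [folklore] -/
theorem conformalRadius_le {b : ℝ} (hb : 0 ≤ b)
    (h : ∀ φ : ℂ → ℂ, IsUnivalentInto K φ → ‖deriv φ 0‖ ≤ b) : conformalRadius K ≤ b := by
  refine csSup_le (insert_nonempty 0 _) ?_
  rintro r (rfl | ⟨φ, hφ, rfl⟩)
  · exact hb
  · exact h φ hφ

/-- The conformal radius is antitone in `K`. [folklore] -/
theorem conformalRadius_mono (hK : K ⊆ K') : conformalRadius K' ≤ conformalRadius K :=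
  conformalRadius_le (conformalRadius_nonneg K) fun _ hφ =>
    (hφ.mono hK).norm_deriv_le_conformalRadius

/-- If `0 ∈ K` the conformal radius is `0`. [folklore] -/
theorem conformalRadius_eq_zero_of_mem (h0 : (0 : ℂ) ∈ K) : conformalRadius K = 0 :=
  le_antisymm (conformalRadius_le le_rfl fun _ hφ => absurd h0 hφ.zero_notMem)
    (conformalRadius_nonneg K)

/-- The dilation `z ↦ d z`, `0 < d ≤ min (dist(0, K)) 1`, is admissible. [folklore] -/
theorem isUnivalentInto_smul {d : ℝ} (hd : 0 < d) (hd1 : d ≤ 1) (hdK : d ≤ infDist (0 : ℂ) K) :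
    IsUnivalentInto K (fun z => (d : ℂ) * z) where
  differentiableOn := (differentiable_id.const_mul _).differentiableOn
  injOn := fun x _ y _ hxy => mul_left_cancel₀ (by exact_mod_cast hd.ne') hxy
  map_zero := mul_zero _
  mapsTo := by
    intro z hz
    rw [mem_ball_zero_iff] at hz
    have hnorm : ‖(d : ℂ) * z‖ < d := by
      rw [norm_mul, Complex.norm_real, Real.norm_of_nonneg hd.le]
      exact mul_lt_of_lt_one_right hd hz
    refine ⟨mem_ball_zero_iff.2 (hnorm.trans_le hd1), fun hK => ?_⟩
    have := infDist_le_dist_of_mem (x := (0 : ℂ)) hK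
    rw [dist_zero_left] at this
    linarith

/-- **`min (dist(0, K)) 1 ≤ 𝔯(K)`**: the dilation by `min (dist(0, K)) 1` is admissible. For
`K ⊇ ∂𝕌` (so `dist(0, K) ≤ 1`) this is the inequality `dist(0, Q) ≤ 𝔯` of LSW (2.1), the
"Schwarz Lemma" half. [cite: LawlerSchrammWernerEJP2002, (2.1) (p. 4)] -/
theorem min_infDist_one_le_conformalRadius (K : Set ℂ) :
    min (infDist (0 : ℂ) K) 1 ≤ conformalRadius K := by
  rcases (le_min (infDist_nonneg (x := (0 : ℂ)) (s := K)) zero_le_one).eq_or_lt with h | h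
  · rw [← h]; exact conformalRadius_nonneg K
  · have hφ := isUnivalentInto_smul (K := K) h (min_le_right _ _) (min_le_left _ _)
    have hd : deriv (fun z : ℂ => ((min (infDist (0 : ℂ) K) 1 : ℝ) : ℂ) * z) 0 =
        ((min (infDist (0 : ℂ) K) 1 : ℝ) : ℂ) := by
      simp
    have := hφ.norm_deriv_le_conformalRadius
    rwa [hd, Complex.norm_real, Real.norm_of_nonneg h.le] at this

/-- If `K` meets the closed unit disc then `dist(0, K) ≤ 𝔯(K)` (LSW (2.1), upper inequality,
for `K ⊇ ∂𝕌`). [cite: LawlerSchrammWernerEJP2002, (2.1) (p. 4)] -/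
theorem infDist_le_conformalRadius (h : infDist (0 : ℂ) K ≤ 1) :
    infDist (0 : ℂ) K ≤ conformalRadius K := by
  have := min_infDist_one_le_conformalRadius K
  rwa [min_eq_left h] at this

/-- **Koebe's one-quarter theorem** (P. Koebe 1907, L. Bieberbach 1916; Lawler 2005, Thm. 3.17:
"If `f ∈ 𝒮`, then `𝓑(0, 1/4) ⊂ f(𝔻)`", `𝒮` the univalent `f` on `𝔻` with `f(0) = 0`,
`f'(0) = 1`), in the un-normalised form used in the proof of Lawler's Cor. 3.19 (apply Thm. 3.17
to `(f - f(0))/f'(0)`; a univalent `f` has `f'(0) ≠ 0`, and for `f'(0) = 0` the ball below is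
empty): the image of the unit disc under a univalent `f` contains the disc of radius `|f'(0)|/4`
about `f(0)`. Rests on the area theorem (Prop. 3.13) and Bieberbach's `|a₂| ≤ 2` (Prop. 3.16);
not in Mathlib. [cite: Lawler2008, Thm. 3.17 (p. 62)] -/
def KoebeQuarter : Prop :=
  ∀ f : ℂ → ℂ, DifferentiableOn ℂ f (ball 0 1) → InjOn f (ball 0 1) →
    ball (f 0) (‖deriv f 0‖ / 4) ⊆ f '' ball 0 1

/-- **Koebe covering with constant `c`**: the image of the unit disc under a univalent `f`
contains the disc of radius `c |f'(0)|` about `f(0)`. Koebe (1907) proved this for some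
absolute `c > 0`; Bieberbach (1916) obtained the sharp `c = 1/4` (`KoebeQuarter`; Lawler
2005, Thm. 3.17). For the one-arm exponent any `c > 0` suffices, so downstream results are
stated for `KoebeCovering c`; `KoebeCovering (1/(128π))` is PROVED (via Bloch–Landau) as
`Complex.ball_subset_image_of_injOn` in `Literature/Analysis/Complex/KoebeCovering.lean`.
[cite: Lawler2008, Thm. 3.17 (p. 62)] -/
def KoebeCovering (c : ℝ) : Prop :=
  ∀ f : ℂ → ℂ, DifferentiableOn ℂ f (ball 0 1) → InjOn f (ball 0 1) →
    ball (f 0) (c * ‖deriv f 0‖) ⊆ f '' ball 0 1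

/-- Koebe's one-quarter theorem is Koebe covering with `c = 1/4`. [folklore] -/
theorem KoebeQuarter.koebeCovering (h : KoebeQuarter) : KoebeCovering (1 / 4) := by
  intro f hf hinj
  rw [one_div, inv_mul_eq_div]
  exact h f hf hinj

/-- **`𝔯(K) ≤ c⁻¹ dist(0, K)`** for nonempty `K`, from Koebe covering with constant `c > 0`: an
admissible `φ` covers the disc of radius `c |φ'(0)|` about `0`, which is therefore free of
`K`. [cite: Lawler2008, Cor. 3.19 (p. 63)] -/
theorem conformalRadius_le_inv_mul_infDist {c : ℝ} (hKoebe : KoebeCovering c) (hc : 0 < c)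
    (hne : K.Nonempty) : conformalRadius K ≤ c⁻¹ * infDist (0 : ℂ) K := by
  refine conformalRadius_le (mul_nonneg (inv_nonneg.2 hc.le) infDist_nonneg) fun φ hφ => ?_
  have hsub := hKoebe φ hφ.differentiableOn hφ.injOn
  rw [hφ.map_zero] at hsub
  suffices c * ‖deriv φ 0‖ ≤ infDist (0 : ℂ) K by
    rw [← div_eq_inv_mul, le_div_iff₀ hc]; linarith
  refine (le_infDist hne).2 fun y hy => ?_
  by_contra hlt
  push Not at hlt
  obtain ⟨z, hz, hzy⟩ := hsub (mem_ball'.2 (by simpa [dist_comm] using hlt))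
  exact (hφ.mapsTo hz).2 (hzy ▸ hy)

/-- **`𝔯(K) ≤ 4 dist(0, K)`** for nonempty `K`, from Koebe's one-quarter theorem: an admissible
`φ` covers the disc of radius `|φ'(0)|/4` about `0`, which is therefore free of `K`. This is the
inequality `𝔯/4 ≤ dist(0, Q)` of LSW (2.1) ("A well known consequence of the Koebe 1/4
Theorem", p. 4; Lawler 2005, Cor. 3.19). [cite: LawlerSchrammWernerEJP2002, (2.1) (p. 4)]
[cite: Lawler2008, Cor. 3.19 (p. 63)] -/
theorem conformalRadius_le_four_mul_infDist (hKoebe : KoebeQuarter) (hne : K.Nonempty) :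
    conformalRadius K ≤ 4 * infDist (0 : ℂ) K := by
  have := conformalRadius_le_inv_mul_infDist hKoebe.koebeCovering (by norm_num) hne
  norm_num at this
  exact this

/-- **LSW (2.1)**: `𝔯/4 ≤ dist(0, K) ≤ 𝔯` for nonempty `K` meeting the closed unit disc (in
LSW, `K = Q(θ) ⊇ ∂𝕌`), given Koebe's one-quarter theorem.
[cite: LawlerSchrammWernerEJP2002, (2.1) (p. 4)] -/
theorem conformalRadius_div_four_le_infDist_le (hKoebe : KoebeQuarter) (hne : K.Nonempty)
    (h : infDist (0 : ℂ) K ≤ 1) :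
    conformalRadius K / 4 ≤ infDist (0 : ℂ) K ∧ infDist (0 : ℂ) K ≤ conformalRadius K :=
  ⟨by linarith [conformalRadius_le_four_mul_infDist hKoebe hne], infDist_le_conformalRadius h⟩

/-! ### Agreement with the Riemann-map definition `𝔯 = 1/ψ'(0)` -/

/-- The image of an admissible map lies in the connected component of `0` in `𝔻 ∖ K` (it is
connected and contains `0 = φ(0)`). [folklore] -/
theorem IsUnivalentInto.mapsTo_connectedComponentIn (h : IsUnivalentInto K φ) :
    MapsTo φ (ball 0 1) (connectedComponentIn (ball 0 1 \ K) 0) := by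
  have hpc : IsPreconnected (φ '' ball 0 1) :=
    (convex_ball (0 : ℂ) 1).isPreconnected.image φ h.differentiableOn.continuousOn
  have h0 : (0 : ℂ) ∈ φ '' ball 0 1 := ⟨0, mem_ball_self one_pos, h.map_zero⟩
  have hsub : φ '' ball 0 1 ⊆ ball 0 1 \ K := h.mapsTo.image_subset
  have := hpc.subset_connectedComponentIn h0 hsub
  exact fun z hz => this (mem_image_of_mem φ hz)

/-- **The extremal conformal radius is LSW's `𝔯 = 1/ψ'(0)`.** Let `K` be closed and let
`U` be the connected component of `0` in `𝔻 ∖ K`. If `ψ : U → 𝔻` is a holomorphic bijection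
with `ψ(0) = 0` and holomorphic inverse (for simply connected `U ∌ ∞`, i.e. always in LSW's
setting, such `ψ` exists by the Riemann mapping theorem, proved in this library as
`Complex.exists_bijOn_ball_of_isSimplyConnected`, which also provides the holomorphy of the
inverse), then `conformalRadius K = 1/|ψ'(0)|` — LSW's definition "`𝔯(θ) := 1/ψ'(0)`" (p. 4).
Proof: `ψ⁻¹` is admissible with `(ψ⁻¹)'(0) = 1/ψ'(0)`; conversely for admissible `φ`, `ψ ∘ φ`
maps `𝔻 → 𝔻` fixing `0`, so `|ψ'(0)| |φ'(0)| ≤ 1` by the Schwarz lemma.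
[cite: LawlerSchrammWernerEJP2002, §2 (p. 4)] [cite: Lawler2008, §3.2 (p. 61)] -/
theorem conformalRadius_eq_inv_norm_deriv (hK : IsClosed K) {ψ : ℂ → ℂ}
    (hψ : DifferentiableOn ℂ ψ (connectedComponentIn (ball 0 1 \ K) 0))
    (hbij : BijOn ψ (connectedComponentIn (ball 0 1 \ K) 0) (ball 0 1)) (hψ0 : ψ 0 = 0)
    (hinv : DifferentiableOn ℂ (Function.invFunOn ψ (connectedComponentIn (ball 0 1 \ K) 0))
      (ball 0 1)) :
    conformalRadius K = ‖deriv ψ 0‖⁻¹ := by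
  set U := connectedComponentIn (ball 0 1 \ K) 0 with hU
  set finv := Function.invFunOn ψ U with hfinv
  have hUopen : IsOpen U := (isOpen_ball.sdiff hK).connectedComponentIn
  have hUsub : U ⊆ ball 0 1 \ K := connectedComponentIn_subset _ _
  -- `0 ∈ U` (otherwise `U = ∅` could not be mapped onto the disc)
  have h0U : (0 : ℂ) ∈ U := by
    by_contra h0
    have hempty : U = ∅ := by
      rw [hU]
      refine connectedComponentIn_eq_empty ?_
      intro h0'
      exact h0 (mem_connectedComponentIn h0')
    have := hbij.surjOn (mem_ball_self (x := (0 : ℂ)) one_pos)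
    rw [hempty, image_empty] at this
    exact this
  have hsurj : ∀ b ∈ ball (0 : ℂ) 1, ∃ a ∈ U, ψ a = b := fun b hb => hbij.surjOn hb
  have hψfinv : ∀ b ∈ ball (0 : ℂ) 1, ψ (finv b) = b := fun b hb =>
    Function.invFunOn_eq (hsurj b hb)
  have hfinvU : ∀ b ∈ ball (0 : ℂ) 1, finv b ∈ U := fun b hb => Function.invFunOn_mem (hsurj b hb)
  have hfinv0 : finv 0 = 0 := by
    have := hbij.injOn.leftInvOn_invFunOn h0U
    rwa [hψ0] at this
  -- derivatives at `0`
  have hdψ : HasDerivAt ψ (deriv ψ 0) 0 := (hψ.differentiableAt (hUopen.mem_nhds h0U)).hasDerivAt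
  have hdfinv : HasDerivAt finv (deriv finv 0) 0 :=
    (hinv.differentiableAt (ball_mem_nhds 0 one_pos)).hasDerivAt
  have hchain : HasDerivAt (fun z => ψ (finv z)) (deriv ψ 0 * deriv finv 0) 0 := by
    have hψ' : HasDerivAt ψ (deriv ψ 0) (finv 0) := by rw [hfinv0]; exact hdψ
    exact hψ'.comp 0 hdfinv
  have hid : HasDerivAt (fun z : ℂ => z) (deriv ψ 0 * deriv finv 0) 0 :=
    hchain.congr_of_eventuallyEq (by
      filter_upwards [ball_mem_nhds (0 : ℂ) one_pos] with z hz
      exact (hψfinv z hz).symm)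
  have hone : deriv ψ 0 * deriv finv 0 = 1 := hid.unique (hasDerivAt_id 0)
  have hψ'ne : deriv ψ 0 ≠ 0 := left_ne_zero_of_mul_eq_one hone
  have hfinv' : deriv finv 0 = (deriv ψ 0)⁻¹ := (eq_inv_of_mul_eq_one_right hone)
  -- `ψ⁻¹` is admissible
  have hadm : IsUnivalentInto K finv := by
    refine ⟨hinv, ?_, hfinv0, fun b hb => hUsub (hfinvU b hb)⟩
    intro b hb b' hb' heq
    have := congrArg ψ heq
    rwa [hψfinv b hb, hψfinv b' hb'] at this
  refine le_antisymm (conformalRadius_le (inv_nonneg.2 (norm_nonneg _)) fun φ hφ => ?_) ?_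
  · -- Schwarz lemma for `ψ ∘ φ`
    have hg : DifferentiableOn ℂ (fun z => ψ (φ z)) (ball 0 1) :=
      hψ.comp hφ.differentiableOn hφ.mapsTo_connectedComponentIn
    have hg0 : ψ (φ 0) = 0 := by rw [hφ.map_zero, hψ0]
    have hmaps : MapsTo (fun z => ψ (φ z)) (ball 0 1) (closedBall (ψ (φ 0)) 1) := by
      intro z hz
      rw [hg0]
      exact ball_subset_closedBall (hbij.mapsTo (hφ.mapsTo_connectedComponentIn hz))
    have hSch : ‖deriv (fun z => ψ (φ z)) 0‖ ≤ 1 := by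
      simpa using Complex.norm_deriv_le_div_of_mapsTo_ball hg hmaps one_pos
    have hdφ : HasDerivAt φ (deriv φ 0) 0 :=
      (hφ.differentiableOn.differentiableAt (ball_mem_nhds 0 one_pos)).hasDerivAt
    have hch : HasDerivAt (fun z => ψ (φ z)) (deriv ψ 0 * deriv φ 0) 0 := by
      have hψ' : HasDerivAt ψ (deriv ψ 0) (φ 0) := by rw [hφ.map_zero]; exact hdψ
      exact hψ'.comp 0 hdφ
    rw [hch.deriv, norm_mul] at hSch
    have hpos : 0 < ‖deriv ψ 0‖ := norm_pos_iff.2 hψ'ne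
    rw [inv_eq_one_div, le_div_iff₀ hpos]
    linarith [mul_comm ‖deriv ψ 0‖ ‖deriv φ 0‖]
  · have := hadm.norm_deriv_le_conformalRadius
    rwa [hfinv', norm_inv] at this

end Literature.Analysis.Complex
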